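import Mathlib
import Summits.Parity.BatemanHorn.Theses.RoughValueTransport

/-!
# Sketch — crux-ideate stmt-Parity-11390 (RoughValueLaw), ideator 2, round 1

First-lemma signatures for idea card `increment-anchoring` (prime-free differential form of
RoughValueLaw + anchoring of the free constant at infinite depth). Signatures only; proofs are
`sorry` by design (crux-ideate stage: no skeleton).
-/

namespace Summit.Parity.BatemanHorn.Cruxes.RoughValueLaw.IncrementAnchoring

open Filter Topology

/-- The inline Buchstab predicate of the crux (ω = 1/u on [1,2], continuous on [1,∞),
(uω(u))' = ω(u-1) for u > 2); unique solution = `buchstabOmega`. -/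
def IsBuchstab (ω : ℝ → ℝ) : Prop :=
  (∀ u : ℝ, 1 ≤ u → u ≤ 2 → ω u = u⁻¹) ∧ ContinuousOn ω (Set.Ici 1) ∧
    (∀ u : ℝ, 2 < u → HasDerivAt (fun t : ℝ => t * ω t) (ω (u - 1)) u)

/-- Jointly rough values of the system at common value-depth `u` (verbatim the crux's finset). -/
noncomputable def roughCount (k : ℕ) (f : Fin k → Polynomial ℤ) (x : ℕ) (u : ℝ) : ℕ :=
  ((Finset.Icc 1 x).filter (fun n : ℕ => ∀ i, 0 < (f i).eval (n : ℤ) ∧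
    ∀ p ∈ Finset.range ⌈(x : ℝ) ^ (((f i).natDegree : ℝ) / u)⌉₊,
      p.Prime → ¬ ((p : ℤ) ∣ (f i).eval (n : ℤ)))).card

/-- Normalised profile `g_x(u) = Φ_f(x,u) (log x)^k / x`. -/
noncomputable def normCount (k : ℕ) (f : Fin k → Polynomial ℤ) (x : ℕ) (u : ℝ) : ℝ :=
  (roughCount k f x u : ℝ) * Real.log x ^ k / (x : ℝ)

/-- The expected infinite-depth constant `B(f) = (C(f)/∏ deg fᵢ) e^{-kγ}`. -/
noncomputable def flConst (k : ℕ) (f : Fin k → Polynomial ℤ) : ℝ :=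
  Literature.NumberTheory.Sieve.batemanHornConst f / (∏ i, ((f i).natDegree : ℝ)) *
    Real.exp (-((k : ℝ) * Real.eulerMascheroniConstant))

/-- **C⁺ = INCREMENT LAW (prime-free differential form of the crux).** For every system and
every Buchstab ω there is ONE constant `A` such that for all `2 < u' < u` the window count
`Φ_f(x,u) − Φ_f(x,u')` — the `n ≤ x` some of whose coordinates `fᵢ(n)` have smallest prime
factor in `[x^{dᵢ/u}, x^{dᵢ/u'})`, hence are COMPOSITE — obeys
`(Φ_f(x,u) − Φ_f(x,u'))(log x)^k/x → A((uω(u))^k − (u'ω(u'))^k)`. -/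
def IncrementLaw : Prop :=
  ∀ (k : ℕ) (f : Fin k → Polynomial ℤ), Literature.NumberTheory.Sieve.IsBatemanHornSystem f →
    ∀ ω : ℝ → ℝ, IsBuchstab ω → ∃ A : ℝ, ∀ u u' : ℝ, 2 < u' → u' < u →
      Tendsto (fun x : ℕ => normCount k f x u - normCount k f x u') atTop
        (𝓝 (A * ((u * ω u) ^ k - (u' * ω u') ^ k)))

/-- **Two-sided fundamental lemma in additive form** (provable now from
`SieveSequence.fundamental_lemma_uniform_holds` + Mertens for the nested sub-systems, exactly
the computation in the route's SieveCalibration sketch): for every ε, for all large depths `U`,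
eventually in `x`, `|g_x(U) − B(f) U^k| ≤ ε` (relative FL error `K e^{-U/deg_max}` times
`B U^k` tends to 0). -/
def FLTwoSided : Prop :=
  ∀ (k : ℕ) (f : Fin k → Polynomial ℤ), Literature.NumberTheory.Sieve.IsBatemanHornSystem f →
    ∀ ε : ℝ, 0 < ε → ∀ᶠ U : ℝ in atTop, ∀ᶠ x : ℕ in atTop,
      |normCount k f x U - flConst k f * U ^ k| ≤ ε

/-- **Buchstab rate** (de Bruijn / Hua: `|ω(u) − e^{-γ}| ≤ ρ(u−1)/u`, superexponentially
small; Tenenbaum III.6, Harman 2007 A.2): `u^k (ω(u) − e^{-γ}) → 0` for every `k`.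
Not yet in the tree (only `harman2007_buchstabOmega_tendsto_holds`); Literature-sized. -/
def BuchstabRate : Prop :=
  ∀ ω : ℝ → ℝ, IsBuchstab ω → ∀ k : ℕ,
    Tendsto (fun u : ℝ => u ^ k * (ω u - Real.exp (-Real.eulerMascheroniConstant))) atTop (𝓝 0)

/-- **FIRST LEMMA (anchoring at infinite depth; pure real analysis).** If a family of
profiles `g x : ℝ → ℝ` has convergent increments `A((uω(u))^k − (u'ω(u'))^k)` on every window
of `(2,∞)` and is anchored additively at infinity to `B u^k`, and `ω → e^{-γ}` with
`u^k(ω(u) − e^{-γ}) → 0`, then every rung converges, the free constant is forced,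
`A = B e^{kγ}`, and `g x u → B e^{kγ} (uω(u))^k`. -/
theorem anchoring (k : ℕ) (ω : ℝ → ℝ) (g : ℕ → ℝ → ℝ) (A B : ℝ)
    (hω : Tendsto ω atTop (𝓝 (Real.exp (-Real.eulerMascheroniConstant))))
    (hrate : Tendsto (fun u : ℝ => u ^ k * (ω u - Real.exp (-Real.eulerMascheroniConstant)))
      atTop (𝓝 0))
    (hFL : ∀ ε : ℝ, 0 < ε → ∀ᶠ U : ℝ in atTop, ∀ᶠ x : ℕ in atTop, |g x U - B * U ^ k| ≤ ε)
    (hD : ∀ u u' : ℝ, 2 < u' → u' < u →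
      Tendsto (fun x : ℕ => g x u - g x u') atTop (𝓝 (A * ((u * ω u) ^ k - (u' * ω u') ^ k)))) :
    (k ≠ 0 → A = B * Real.exp ((k : ℝ) * Real.eulerMascheroniConstant)) ∧
      ∀ u : ℝ, 2 < u → Tendsto (fun x : ℕ => g x u) atTop
        (𝓝 (B * Real.exp ((k : ℝ) * Real.eulerMascheroniConstant) * (u * ω u) ^ k)) := by
  sorry

/-- **Reduction of the crux to its prime-free differential form** (bookkeeping over
`anchoring`, system by system, with `g := normCount k f`, `B := flConst k f`). -/
theorem roughValueLaw_of_incrementLaw (hFL : FLTwoSided) (hrate : BuchstabRate)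
    (hD : IncrementLaw) :
    Summit.Parity.BatemanHorn.Theses.RoughValueTransport.RoughValueLaw := by
  sorry

/-- Converse direction (trivial: differences of convergent sequences), recorded so that the
transfer is an EQUIVALENCE modulo the two provable facts. -/
theorem incrementLaw_of_roughValueLaw
    (h : Summit.Parity.BatemanHorn.Theses.RoughValueTransport.RoughValueLaw) :
    IncrementLaw := by
  sorry

end Summit.Parity.BatemanHorn.Cruxes.RoughValueLaw.IncrementAnchoring
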